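import Literature.MathematicalPhysics.QuantumFieldTheory.Balaban1983to89.Beta.AssemblyRemainder

/-!
# `Balaban1983to89.Beta.LargeL` — the ONE-STEP / LARGE-`L` form of the located flow input: a log-growth lower
bound of the one-loop coefficients in the blocking factor `L`, uniform in the scale, gives (AF-0) for ALL scales
once `L ≥ L₁`, hence Theorem 2 AS PRINTED with no finite small-`k` list (β sub-cell LEAD, BETA-SPEC v1.7 §8.6)

CITATION HEADER (lean-in-tree rule 2026-08-18).  Source under audit: T. Bałaban, *Renormalization group approach to
lattice gauge field theories. I. Generation of effective actions in a small field approximation and a coupling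
constant renormalization in four dimensions*, Commun. Math. Phys. **109**, 249–301 (1987), doi:10.1007/bf01215223
[Balaban1987RG1] (cell paper B12; held `paper:balaban1987-cmp109-rg-i-small-field`, journal page = PDF page + 248),
with *Renormalization group approach to lattice gauge field theories. II. Cluster expansions*, Commun. Math. Phys.
**116**, 1–22 (1988) [Balaban1988RG2Cluster] (B13) and *Large field renormalization. II*, Commun. Math. Phys. **122**,
355–392 (1989) [Balaban1989LargeFieldII] (B16).  Locators used: Theorem 2 p. 259 with (0.31); the one-loop split
(1.3)/(1.6) pp. 260–261 and (2.12)–(2.14) p. 268 (`B12Beta.OneLoopSplit`); (1.22) p. 264 (β as a second moment of the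
vacuum polarization of the k-th fluctuation integral); the lattice convention p. 251 l. 23 «where L is an odd, positive
integer > 11, and m is a positive integer» (v1.3 DOCFIX, GAPS G-ref1-20 (b) / C-ref5-27: v1–v1.2 carried three locators here that
are NOT printed where they pointed — p. 255, p. 262 and [Balaban1985Averaging] §1, which prints on p. 17 «where L is a fixed
integer, L > 1» — all withdrawn); [Balaban1989LargeFieldII] p. 355 ("second order perturbative calculations … has not been published yet").  What is
reproduced: NOTHING is newly quoted — every printed input enters through the imported modules (`FlowStep`,
`FlowStepRuns`, `B12Beta`, `Beta.Assembly`, `Beta.RemainderChain`, `Beta.AssemblyRemainder`), whose citation headers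
carry the verbatim quotations.  This module is BOOKKEEPING over a TYPED TARGET of the cell's own analysis.

HONEST FRAMING (cell rule, verbatim, page 1 of everything): discharging BetaPertH makes Bałaban's UV stability
UNCONDITIONAL — a real constructive-QFT result; it is NOT the continuum limit and NOT the Clay problem.

ABSOLUTE RULE (cell rule, verbatim): "No internally-minted statement may enter as a cited fact. Every hypothesis is
either kernel-proved in this package or a verbatim quotation of a PUBLISHED theorem with page reference. The
manuscript(s) under audit are NOT citable for their own disputed steps — they are the thing under adjudication;
programme-internal (2001/route/tribunal) claims are never citable."  In particular [Balaban1987RG1] is NOT cited here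
for any property of its β-functions beyond the split (2.12)–(2.14) and the formula (1.22); the target (AF-0-L) below is
the β sub-cell LEAD'S TYPED TARGET (cell file HOME/BETA-SPEC.md v1.7 §8.6) — an UNPRINTED, UNPROVED hypothesis shape,
asserted nowhere in this module; the expected slope `(11N²/12π²)` (cell module `B12Normalization.stepBal`) is context
only and enters no statement here.

WHAT THIS MODULE IS.  The cell has located the single unprinted analytic input of [Balaban1987RG1] Theorem 2 at
END-STATEMENT grade as ONE positivity statement on the coupling-free ("one-loop", Gaussian) parts `β⁰_{k+1}` of the
printed split `β_{k+1} = β⁰_{k+1} + β¹_{k+1}(g_0,…,g_k)` (cell: BETA-SPEC §6.2 (M2⁺); carriers `Beta.Assembly.EventualForm`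
/ `BoundedForm` / `LimitForm`).  Those coefficients depend on the scale `k` (through the depth `η = L^{−k}` of the fine
lattice inside the k-th fluctuation integral) AND on the blocking factor `L` of the construction (an odd integer `> 11` in
[Balaban1987RG1] p. 251, chosen large — no quotation).  The lead's ONE-STEP / LARGE-`L` form of the target quantifies over
both:
  (AF-0-L)  `∃ b > 0, A ≥ 0 : ∀ L ≥ 2, ∀ k ≥ 0 :  b · log L − A ≤ β⁰_{k+1}(L)`       (`LogGrowthLower`, §1),
the shape that a one-loop ("window `1 ≪ |w| ≪ L` on the fluctuation lattice") analysis of ONE renormalization step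
would deliver, with `b` the coefficient of `log L` and `A` a bound on the scheme-dependent remainder uniform in the
scale and in `L` (BETA-SPEC v1.7 §8.6 decomposes it into located sub-lemmas; none is printed, none is proved).
From (AF-0-L) ALONE this module proves, kernel-checked and with no placeholders:
  * an explicit threshold `L₁(b, A, b₀) = max 2 ⌈exp((A + 2b₀)/b)⌉` with `2b₀ ≤ β⁰_{k+1}(L)` for EVERY `k` once
    `L ≥ L₁` (`uniform_lower`, §2) — i.e. (AF-0) of `FlowStep`/`B12Beta` for ALL scales, not merely eventually;
  * hence, at any such `L`, with row an4's CONSTANT-FORM remainder bound `|β¹_{k+1}| ≤ r ≤ b₀` on ]0,γ]-histories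
    (`Beta.RemainderChain.RemainderConst`, printed chain modulo rowed leaves): the pointwise lower bound
    `b₀ ≤ β_{k+1}` on all boxes (`betaLowerH`, = `FlowStep.BetaLowerH`), `FlowStep.BetaAFH` (`betaAFH`), the minimal
    carrier `Beta.Assembly.EventualForm` with `k₀ = 0` (`eventualForm`, `eventualForm_k₀`), endpoint existence
    (`endpointExistence`) and — the point of the large-`L` form — [Balaban1987RG1] THEOREM 2 AS PRINTED, `B12.Thm2Printed`,
    with NO finite list of small-`k` signs (`thm2Printed`: the list slot of `EventualForm.thm2Printed_of_list` is vacuous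
    at `k₀ = 0`), for forward-generated constructions;
  * the two-sided variant `LogGrowth` (`|β⁰_{k+1}(L) − b log L| ≤ A`) implies the one-sided one (`LogGrowth.lower`), and a
    non-vacuity witness (`Witness.logGrowth_model`).
WHAT IT DOES NOT DO: it proves nothing about Bałaban's (1.22); (AF-0-L) is OPEN.  Compared with the cell's other typed
forms it is STRONGER than (EV-AF)/(MB)/(LIM) at fixed `L` in that it asks uniformity in `L`, and WEAKER in that it needs no
`η → 0` limit, no rate, no composed functional and no value: its discharge would be a one-step estimate.  The extra
hypothesis "`L ≥ L₁`" is of the series' own standing type (a large blocking factor; no quotation).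
v1.1 (append-only; every v1 declaration byte-unchanged): §5 relativises the shape to a predicate of ADMISSIBLE blocking factors
(`LogGrowthLowerOn Adm β0 b A`: the series restricts `L`, e.g. [Balaban1987RG1] p. 251 "L odd" and large), with the same
threshold bookkeeping (`uniform_lower_on`, `exists_admissible_threshold` under unboundedness of `Adm`) and the one-line
bridges from the unrestricted shapes (`LogGrowthLower.on`); a discharge of (AF-0-L) need only cover admissible `L`.
v1.2 (DOCSTRING ONLY; beta-ref R49 REMARK 1/2 = C-beta-28, re-stated R62): ORDER OF CONSTANTS.  The consumer chain of §3 is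
acyclic ONLY in the order  `b, A` (absolute: from the target (AF-0-L); volume-free by RULING (R3), BETA-SPEC v1.8b §8.6 (l))
→ `b₀ > 0` free → `L₁(b, A, b₀)` → the blocking factor `L ≥ L₁` (admissible) → the construction's constants chosen AFTER `L`
(`M`, `κ`, `α₂`, …, hence row an4's `K_rem(L)`) → `ε₁ ≤ b₀ / K_rem(L)`, so that the constant-form remainder bound reads
`r = ε₁·K_rem(L) ≤ b₀` (`Beta.RemainderChain.RemainderConst`; admissible because `ε₁` carries only UPPER bounds in print,
beta-ref R39 (ii)).  In `thm2Printed` the real `Lr > 1` of `B12.Thm2Printed C Lr` is a free normalisation parameter; the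
printed (0.31) is the case `Lr = L` — consumers cite `thm2Printed_self`.  No declaration changed.
v1.3 (DOCSTRING ONLY; GAPS G-ref1-20 (b), ref1 gen 14 R48.1): the three bad locators of the citation header and of the
`exists_threshold` tag (p. 255, p. 262, [Balaban1985Averaging] §1) replaced by p. 251 l. 23 or dropped; no declaration changed.
-/

namespace Literature.MathematicalPhysics.QuantumFieldTheory.Balaban1983to89.Beta.LargeL

open Literature.MathematicalPhysics.QuantumFieldTheory.Balaban1983to89
open Literature.MathematicalPhysics.QuantumFieldTheory.Balaban1983to89.FlowStep
open Literature.MathematicalPhysics.QuantumFieldTheory.Balaban1983to89.DagBinding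
open Literature.MathematicalPhysics.QuantumFieldTheory.Balaban1983to89.FlowStepRuns
open Literature.MathematicalPhysics.QuantumFieldTheory.Balaban1983to89.Beta.Assembly
open Literature.MathematicalPhysics.QuantumFieldTheory.Balaban1983to89.Beta.RemainderChain
open Literature.MathematicalPhysics.QuantumFieldTheory.Balaban1983to89.Beta.AssemblyRemainder

noncomputable section

/-! ## 1. The typed target (AF-0-L) — a hypothesis SHAPE over an `L`-indexed family of one-loop coefficient sequences -/

/-- (AF-0-L), one-sided: the one-loop coefficients `β0 L k` (= `β⁰_{k+1}` of the construction with blocking factor `L`)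
are bounded below by `b·log L − A` for every `L ≥ 2` and EVERY scale `k`.  The β sub-cell lead's typed target
(BETA-SPEC v1.7 §8.6); UNPRINTED and UNPROVED for [Balaban1987RG1] (1.22) — a hypothesis shape, nothing asserted.
[cite: Balaban1987RG1, (1.22) p.264 and (2.12)–(2.14) p.268] -/
def LogGrowthLower (β0 : ℕ → ℕ → ℝ) (b A : ℝ) : Prop :=
  ∀ L : ℕ, 2 ≤ L → ∀ k : ℕ, b * Real.log L - A ≤ β0 L k

/-- (AF-0-L), two-sided: `|β0 L k − b·log L| ≤ A` for every `L ≥ 2` and every `k` — the shape "universal logarithm +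
remainder bounded uniformly in the scale and in `L`".  Hypothesis shape, nothing asserted.
[cite: Balaban1987RG1, (1.22) p.264] -/
def LogGrowth (β0 : ℕ → ℕ → ℝ) (b A : ℝ) : Prop :=
  ∀ L : ℕ, 2 ≤ L → ∀ k : ℕ, |β0 L k - b * Real.log L| ≤ A

/-- The two-sided form implies the one-sided form. [folklore] -/
theorem LogGrowth.lower {β0 : ℕ → ℕ → ℝ} {b A : ℝ} (h : LogGrowth β0 b A) : LogGrowthLower β0 b A := by
  intro L hL k
  have h1 := (abs_le.mp (h L hL k)).1
  linarith

/-- Monotonicity in the constants: a smaller slope (still with the same `A`) and a larger `A` keep the one-sided form,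
provided the slope stays non-negative. [folklore] -/
theorem LogGrowthLower.mono {β0 : ℕ → ℕ → ℝ} {b b' A A' : ℝ} (h : LogGrowthLower β0 b A) (hb' : 0 ≤ b')
    (hbb : b' ≤ b) (hAA : A ≤ A') : LogGrowthLower β0 b' A' := by
  intro L hL k
  have hlog : 0 ≤ Real.log (L : ℝ) := Real.log_nonneg (by exact_mod_cast (by omega : 1 ≤ L))
  have h1 := h L hL k
  have _ := hb'
  nlinarith

/-! ## 2. The threshold `L₁` and (AF-0) for ALL scales -/

/-- Elementary: `(A + 2b₀)/b ≤ log x` with `b > 0` gives `2b₀ ≤ b·log x − A`. [folklore] -/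
theorem two_mul_le_of_log {b A b₀ x : ℝ} (hb : 0 < b) (hx : (A + 2 * b₀) / b ≤ Real.log x) :
    2 * b₀ ≤ b * Real.log x - A := by
  have h := mul_le_mul_of_nonneg_left hx hb.le
  have hc : b * ((A + 2 * b₀) / b) = A + 2 * b₀ := by field_simp
  linarith

/-- Elementary: `exp t ≤ L` (a natural number `L ≥ 1`) gives `t ≤ log L`. [folklore] -/
theorem le_log_of_exp_le {t : ℝ} {L : ℕ} (h : Real.exp t ≤ L) : t ≤ Real.log L := by
  calc t = Real.log (Real.exp t) := (Real.log_exp t).symm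
    _ ≤ Real.log L := Real.log_le_log (Real.exp_pos t) h

/-- The explicit threshold `L₁ = max 2 ⌈exp((A + 2b₀)/b)⌉`. [folklore] -/
def L₁ (b A b₀ : ℝ) : ℕ := max 2 ⌈Real.exp ((A + 2 * b₀) / b)⌉₊

/-- `2 ≤ L₁`. [folklore] -/
theorem two_le_L₁ (b A b₀ : ℝ) : 2 ≤ L₁ b A b₀ := le_max_left _ _

/-- For `L ≥ L₁`, `exp((A + 2b₀)/b) ≤ L`. [folklore] -/
theorem exp_le_of_L₁_le {b A b₀ : ℝ} {L : ℕ} (hL : L₁ b A b₀ ≤ L) : Real.exp ((A + 2 * b₀) / b) ≤ L := by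
  have h1 : Real.exp ((A + 2 * b₀) / b) ≤ (⌈Real.exp ((A + 2 * b₀) / b)⌉₊ : ℝ) := Nat.le_ceil _
  have h2 : ((⌈Real.exp ((A + 2 * b₀) / b)⌉₊ : ℕ) : ℝ) ≤ (L : ℝ) := by
    exact_mod_cast (le_max_right _ _).trans hL
  exact h1.trans h2

/-- For `L ≥ L₁`, `(A + 2b₀)/b ≤ log L`. [folklore] -/
theorem div_le_log_of_L₁_le {b A b₀ : ℝ} {L : ℕ} (hL : L₁ b A b₀ ≤ L) : (A + 2 * b₀) / b ≤ Real.log L :=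
  le_log_of_exp_le (exp_le_of_L₁_le hL)

/-- **(AF-0-L) ⇒ (AF-0) for EVERY scale at every `L ≥ L₁(b, A, b₀)`**: `2b₀ ≤ β0 L k` for all `k`.  Pure bookkeeping
from the hypothesis shape; nothing about (1.22) is asserted. [cite: Balaban1987RG1, (2.12)–(2.14) p.268] -/
theorem uniform_lower {β0 : ℕ → ℕ → ℝ} {b A : ℝ} (h : LogGrowthLower β0 b A) (hb : 0 < b) (b₀ : ℝ) {L : ℕ}
    (hL : L₁ b A b₀ ≤ L) : ∀ k, 2 * b₀ ≤ β0 L k := fun k =>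
  (two_mul_le_of_log hb (div_le_log_of_L₁_le hL)).trans (h L ((two_le_L₁ b A b₀).trans hL) k)

/-- The same with the threshold stated as `exp((A + 2b₀)/b) ≤ L`, `2 ≤ L` (no ceiling). [folklore] -/
theorem uniform_lower_of_exp_le {β0 : ℕ → ℕ → ℝ} {b A : ℝ} (h : LogGrowthLower β0 b A) (hb : 0 < b) (b₀ : ℝ)
    {L : ℕ} (hL2 : 2 ≤ L) (hL : Real.exp ((A + 2 * b₀) / b) ≤ L) : ∀ k, 2 * b₀ ≤ β0 L k := fun k =>
  (two_mul_le_of_log hb (le_log_of_exp_le hL)).trans (h L hL2 k)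

/-! ## 3. Consumers at a fixed admissible `L`: the β-family `β` of THAT construction, its printed split `S`, and the
dictionary clause `S.β0 = β0 L` -/

section Consumers

variable {β0 : ℕ → ℕ → ℝ} {b A b₀ : ℝ} {L : ℕ} {β : HBeta} (S : B12Beta.OneLoopSplit β)

/-- (AF-0) for all scales, on the split of the construction with blocking factor `L ≥ L₁`. [cite: Balaban1987RG1, (2.12)–(2.14) p.268] -/
theorem af0_all (h : LogGrowthLower β0 b A) (hb : 0 < b) (hL : L₁ b A b₀ ≤ L) (hS : ∀ k, S.β0 k = β0 L k) :
    ∀ k, 2 * b₀ ≤ S.β0 k := fun k => by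
  rw [hS k]
  exact uniform_lower h hb b₀ hL k

/-- **Pointwise asymptotic freedom on ALL boxes** from (AF-0-L) at `L ≥ L₁` and the CONSTANT-FORM remainder bound
`|β¹_{k+1}| ≤ r ≤ b₀` on ]0,γ]-histories (row an4, `Beta.RemainderChain.betaLowerH_of_split_const`): `b₀ ≤ β_{k+1}` on
]0,γ]^{k+1} for every `k`. [cite: Balaban1987RG1, §1 p.264 and (2.12)–(2.14) p.268] -/
theorem betaLowerH (h : LogGrowthLower β0 b A) (hb : 0 < b) (hL : L₁ b A b₀ ≤ L) (hS : ∀ k, S.β0 k = β0 L k)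
    {γ r : ℝ} (hrem : RemainderConst S γ r) (hr : r ≤ b₀) : BetaLowerH b₀ γ β :=
  betaLowerH_of_split_const S (af0_all S h hb hL hS) hrem hr

/-- Hence `FlowStep.BetaAFH β` (the (0.31)-type uniform positive lower bound on some box) when `b₀ > 0`, `γ > 0`.
[cite: Balaban1987RG1, Thm 2 (0.31) p.259] -/
theorem betaAFH (h : LogGrowthLower β0 b A) (hb : 0 < b) (hL : L₁ b A b₀ ≤ L) (hS : ∀ k, S.β0 k = β0 L k)
    {γ r : ℝ} (hγ : 0 < γ) (hb₀ : 0 < b₀) (hrem : RemainderConst S γ r) (hr : r ≤ b₀) : BetaAFH β :=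
  ⟨γ, hγ, b₀, hb₀, betaLowerH S h hb hL hS hrem hr⟩

/-- **The minimal carrier with `k₀ = 0`**: (AF-0-L) at `L ≥ L₁`, the constant-form remainder `r ≤ b₀`, the printed
two-sided bound `−β′ ≤ β ≤ β′` and joint continuity (C) give `Beta.Assembly.EventualForm β` whose tail starts at scale 0
(`Beta.AssemblyRemainder.eventualForm_of_remainderConst`). [cite: Balaban1987RG1, §1 p.264] -/
def eventualForm (h : LogGrowthLower β0 b A) (hb : 0 < b) (hL : L₁ b A b₀ ≤ L) (hS : ∀ k, S.β0 k = β0 L k)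
    {γ₀ r β' : ℝ} (hγ₀ : 0 < γ₀) (hb₀ : 0 < b₀) (hrem : RemainderConst S γ₀ r) (hr : r ≤ b₀)
    (hup : BetaUpperH β' γ₀ β) (hlo : ∀ k, ∀ v ∈ Box γ₀ k, -β' ≤ β k v) (hcont : BetaContH γ₀ β) :
    EventualForm β :=
  eventualForm_of_remainderConst S hγ₀ hb₀ (k₀ := 0) (fun k _ => af0_all S h hb hL hS k) hrem hr hup hlo hcont

/-- Its tail index is `k₀ = 0` and its lower constant is `b₀`. [folklore] -/
theorem eventualForm_k₀ (h : LogGrowthLower β0 b A) (hb : 0 < b) (hL : L₁ b A b₀ ≤ L) (hS : ∀ k, S.β0 k = β0 L k)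
    {γ₀ r β' : ℝ} (hγ₀ : 0 < γ₀) (hb₀ : 0 < b₀) (hrem : RemainderConst S γ₀ r) (hr : r ≤ b₀)
    (hup : BetaUpperH β' γ₀ β) (hlo : ∀ k, ∀ v ∈ Box γ₀ k, -β' ≤ β k v) (hcont : BetaContH γ₀ β) :
    (eventualForm S h hb hL hS hγ₀ hb₀ hrem hr hup hlo hcont).k₀ = 0 ∧
      (eventualForm S h hb hL hS hγ₀ hb₀ hrem hr hup hlo hcont).b = b₀ := ⟨rfl, rfl⟩

/-- **Endpoint existence** ([Balaban1987RG1] Thm 2, first sentence; cell `DagBinding.EndpointExistence`) for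
forward-generated constructions, from (AF-0-L) at `L ≥ L₁` + constant-form remainder + printed bounds + (C).
[cite: Balaban1987RG1, Thm 2 p.259 (first sentence)] -/
theorem endpointExistence (h : LogGrowthLower β0 b A) (hb : 0 < b) (hL : L₁ b A b₀ ≤ L)
    (hS : ∀ k, S.β0 k = β0 L k) {γ₀ r β' : ℝ} (hγ₀ : 0 < γ₀) (hb₀ : 0 < b₀) (hrem : RemainderConst S γ₀ r)
    (hr : r ≤ b₀) (hup : BetaUpperH β' γ₀ β) (hlo : ∀ k, ∀ v ∈ Box γ₀ k, -β' ≤ β k v) (hcont : BetaContH γ₀ β)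
    {C : B12.Construction} (hgen : ForwardGenerated C β) : EndpointExistence C :=
  (eventualForm S h hb hL hS hγ₀ hb₀ hrem hr hup hlo hcont).endpointExistence hgen

/-- **THEOREM 2 AS PRINTED with NO small-`k` list**: at `L ≥ L₁` the carrier's tail starts at `k₀ = 0`, so the finite
list slot of `Beta.Assembly.EventualForm.thm2Printed_of_list` is vacuous; `Lr > 1` is the real parameter of
`B12.Thm2Printed` (the `β = b/log L` normalisation of (0.31)), to be instantiated with `(L : ℝ)`.
[cite: Balaban1987RG1, Thm 2 p.259 with (0.31)] -/
theorem thm2Printed (h : LogGrowthLower β0 b A) (hb : 0 < b) (hL : L₁ b A b₀ ≤ L) (hS : ∀ k, S.β0 k = β0 L k)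
    {γ₀ r β' : ℝ} (hγ₀ : 0 < γ₀) (hb₀ : 0 < b₀) (hrem : RemainderConst S γ₀ r) (hr : r ≤ b₀)
    (hup : BetaUpperH β' γ₀ β) (hlo : ∀ k, ∀ v ∈ Box γ₀ k, -β' ≤ β k v) (hcont : BetaContH γ₀ β)
    {C : B12.Construction} (hgen : ForwardGenerated C β) {Lr : ℝ} (hLr : 1 < Lr) : B12.Thm2Printed C Lr :=
  (eventualForm S h hb hL hS hγ₀ hb₀ hrem hr hup hlo hcont).thm2Printed_of_list hgen hLr
    (fun k hk => absurd hk (Nat.not_lt_zero k))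

/-- The same instantiated at the construction's own blocking factor, `Lr = L` (`L ≥ L₁ ≥ 2 > 1`).
[cite: Balaban1987RG1, Thm 2 p.259 with (0.31)] -/
theorem thm2Printed_self (h : LogGrowthLower β0 b A) (hb : 0 < b) (hL : L₁ b A b₀ ≤ L) (hS : ∀ k, S.β0 k = β0 L k)
    {γ₀ r β' : ℝ} (hγ₀ : 0 < γ₀) (hb₀ : 0 < b₀) (hrem : RemainderConst S γ₀ r) (hr : r ≤ b₀)
    (hup : BetaUpperH β' γ₀ β) (hlo : ∀ k, ∀ v ∈ Box γ₀ k, -β' ≤ β k v) (hcont : BetaContH γ₀ β)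
    {C : B12.Construction} (hgen : ForwardGenerated C β) : B12.Thm2Printed C L := by
  have h2 : 2 ≤ L := (two_le_L₁ b A b₀).trans hL
  exact thm2Printed S h hb hL hS hγ₀ hb₀ hrem hr hup hlo hcont hgen (by exact_mod_cast (by omega : 1 < L))

end Consumers

/-! ## 4. Non-vacuity of the hypothesis shape, and the order of quantifiers made explicit -/

namespace Witness

/-- The model family `β0 L k := b·log L` satisfies the two-sided form with `A = 0`. [folklore] -/
theorem logGrowth_model (b : ℝ) : LogGrowth (fun L _ => b * Real.log L) b 0 := by
  intro L _ k
  simp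

/-- … and the one-sided form. [folklore] -/
theorem logGrowthLower_model (b : ℝ) : LogGrowthLower (fun L _ => b * Real.log L) b 0 :=
  (logGrowth_model b).lower

/-- A family with a scale-dependent but `L`-uniformly bounded oscillation, `β0 L k = b·log L + (−1)^k·A`, satisfies the
two-sided form — the shape does NOT require the coefficients to converge in `k`. [folklore] -/
theorem logGrowth_oscillating (b A : ℝ) (hA : 0 ≤ A) :
    LogGrowth (fun L k => b * Real.log L + (-1) ^ k * A) b A := by
  intro L _ k
  have h1 : |((-1 : ℝ) ^ k)| = 1 := by simp
  have : b * Real.log L + (-1) ^ k * A - b * Real.log L = (-1) ^ k * A := by ring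
  rw [this, abs_mul, h1, one_mul, abs_of_nonneg hA]

end Witness

/-- ORDER OF QUANTIFIERS (recorded as a theorem so that no consumer mis-reads the shape): from (AF-0-L) with `b > 0`,
for EVERY target constant `b₀` there is a threshold beyond which all one-loop coefficients of all scales exceed `2b₀` —
`L` is chosen AFTER `b, A, b₀`, as the series fixes its (odd, `> 11`, [Balaban1987RG1] p. 251) blocking factor before the
other constants.  (v1.3 DOCFIX G-ref1-20 (b): the v1 tag cited p. 262 for a phrase not printed there.) [folklore] -/
theorem exists_threshold {β0 : ℕ → ℕ → ℝ} {b A : ℝ} (h : LogGrowthLower β0 b A) (hb : 0 < b) (b₀ : ℝ) :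
    ∃ L₀ : ℕ, 2 ≤ L₀ ∧ ∀ L, L₀ ≤ L → ∀ k, 2 * b₀ ≤ β0 L k :=
  ⟨L₁ b A b₀, two_le_L₁ b A b₀, fun _ hL => uniform_lower h hb b₀ hL⟩

/-! ## 5. (v1.1) The shape relativised to ADMISSIBLE blocking factors -/

/-- (AF-0-L) on an admissibility predicate `Adm` (e.g. "`L` odd and `L > 11`", [Balaban1987RG1] p. 251): the log-growth
lower bound is asked only for admissible `L ≥ 2`.  Hypothesis shape, nothing asserted; a discharge of the lead's target
need only cover admissible `L`. [cite: Balaban1987RG1, p.251 and (1.22) p.264] -/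
def LogGrowthLowerOn (Adm : ℕ → Prop) (β0 : ℕ → ℕ → ℝ) (b A : ℝ) : Prop :=
  ∀ L : ℕ, Adm L → 2 ≤ L → ∀ k : ℕ, b * Real.log L - A ≤ β0 L k

/-- The unrestricted shape implies the relativised one for every predicate. [folklore] -/
theorem LogGrowthLower.on {β0 : ℕ → ℕ → ℝ} {b A : ℝ} (h : LogGrowthLower β0 b A) (Adm : ℕ → Prop) :
    LogGrowthLowerOn Adm β0 b A := fun L _ hL k => h L hL k

/-- The relativised shape with the trivial predicate is the unrestricted shape. [folklore] -/
theorem logGrowthLowerOn_true_iff {β0 : ℕ → ℕ → ℝ} {b A : ℝ} :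
    LogGrowthLowerOn (fun _ => True) β0 b A ↔ LogGrowthLower β0 b A :=
  ⟨fun h L hL k => h L trivial hL k, fun h => h.on _⟩

/-- **(AF-0-L) on `Adm` ⇒ (AF-0) for every scale at every ADMISSIBLE `L ≥ L₁(b, A, b₀)`.**
[cite: Balaban1987RG1, (2.12)–(2.14) p.268] -/
theorem uniform_lower_on {Adm : ℕ → Prop} {β0 : ℕ → ℕ → ℝ} {b A : ℝ} (h : LogGrowthLowerOn Adm β0 b A) (hb : 0 < b)
    (b₀ : ℝ) {L : ℕ} (hAdm : Adm L) (hL : L₁ b A b₀ ≤ L) : ∀ k, 2 * b₀ ≤ β0 L k := fun k =>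
  (two_mul_le_of_log hb (div_le_log_of_L₁_le hL)).trans (h L hAdm ((two_le_L₁ b A b₀).trans hL) k)

/-- If admissible blocking factors are unbounded (as "L odd, L > 11" are), an admissible `L ≥ L₁` exists, and there
(AF-0) holds for every scale. [cite: Balaban1987RG1, p.251 and p.262] -/
theorem exists_admissible_threshold {Adm : ℕ → Prop} {β0 : ℕ → ℕ → ℝ} {b A : ℝ} (h : LogGrowthLowerOn Adm β0 b A)
    (hb : 0 < b) (b₀ : ℝ) (hunb : ∀ n : ℕ, ∃ L, n ≤ L ∧ Adm L) :
    ∃ L : ℕ, Adm L ∧ L₁ b A b₀ ≤ L ∧ ∀ k, 2 * b₀ ≤ β0 L k := by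
  obtain ⟨L, hL, hAdm⟩ := hunb (L₁ b A b₀)
  exact ⟨L, hAdm, hL, uniform_lower_on h hb b₀ hAdm hL⟩

/-- The predicate "`L` odd and `11 < L`" is unbounded (witness `2n + 13`). [folklore] -/
theorem odd_gt_eleven_unbounded : ∀ n : ℕ, ∃ L, n ≤ L ∧ (Odd L ∧ 11 < L) := fun n =>
  ⟨2 * n + 13, by omega, ⟨n + 6, by ring⟩, by omega⟩

section ConsumersOn

variable {Adm : ℕ → Prop} {β0 : ℕ → ℕ → ℝ} {b A b₀ : ℝ} {L : ℕ} {β : HBeta} (S : B12Beta.OneLoopSplit β)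

/-- (AF-0) for all scales on the split of an ADMISSIBLE construction with `L ≥ L₁`. [cite: Balaban1987RG1, (2.12)–(2.14) p.268] -/
theorem af0_all_on (h : LogGrowthLowerOn Adm β0 b A) (hb : 0 < b) (hAdm : Adm L) (hL : L₁ b A b₀ ≤ L)
    (hS : ∀ k, S.β0 k = β0 L k) : ∀ k, 2 * b₀ ≤ S.β0 k := fun k => by
  rw [hS k]
  exact uniform_lower_on h hb b₀ hAdm hL k

/-- The minimal carrier with `k₀ = 0` at an admissible `L ≥ L₁`, from the relativised shape + constant-form remainder +
printed bounds + (C). [cite: Balaban1987RG1, §1 p.264] -/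
def eventualFormOn (h : LogGrowthLowerOn Adm β0 b A) (hb : 0 < b) (hAdm : Adm L) (hL : L₁ b A b₀ ≤ L)
    (hS : ∀ k, S.β0 k = β0 L k) {γ₀ r β' : ℝ} (hγ₀ : 0 < γ₀) (hb₀ : 0 < b₀) (hrem : RemainderConst S γ₀ r)
    (hr : r ≤ b₀) (hup : BetaUpperH β' γ₀ β) (hlo : ∀ k, ∀ v ∈ Box γ₀ k, -β' ≤ β k v) (hcont : BetaContH γ₀ β) :
    EventualForm β :=
  eventualForm_of_remainderConst S hγ₀ hb₀ (k₀ := 0) (fun k _ => af0_all_on S h hb hAdm hL hS k) hrem hr hup hlo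
    hcont

/-- THEOREM 2 AS PRINTED at an admissible `L ≥ L₁`, no small-`k` list. [cite: Balaban1987RG1, Thm 2 p.259 with (0.31)] -/
theorem thm2Printed_on (h : LogGrowthLowerOn Adm β0 b A) (hb : 0 < b) (hAdm : Adm L) (hL : L₁ b A b₀ ≤ L)
    (hS : ∀ k, S.β0 k = β0 L k) {γ₀ r β' : ℝ} (hγ₀ : 0 < γ₀) (hb₀ : 0 < b₀) (hrem : RemainderConst S γ₀ r)
    (hr : r ≤ b₀) (hup : BetaUpperH β' γ₀ β) (hlo : ∀ k, ∀ v ∈ Box γ₀ k, -β' ≤ β k v) (hcont : BetaContH γ₀ β)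
    {C : B12.Construction} (hgen : ForwardGenerated C β) : B12.Thm2Printed C L := by
  have h2 : 2 ≤ L := (two_le_L₁ b A b₀).trans hL
  exact (eventualFormOn S h hb hAdm hL hS hγ₀ hb₀ hrem hr hup hlo hcont).thm2Printed_of_list hgen
    (by exact_mod_cast (by omega : 1 < L)) (fun k hk => absurd hk (Nat.not_lt_zero k))

/-- Endpoint existence at an admissible `L ≥ L₁`. [cite: Balaban1987RG1, Thm 2 p.259 (first sentence)] -/
theorem endpointExistence_on (h : LogGrowthLowerOn Adm β0 b A) (hb : 0 < b) (hAdm : Adm L) (hL : L₁ b A b₀ ≤ L)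
    (hS : ∀ k, S.β0 k = β0 L k) {γ₀ r β' : ℝ} (hγ₀ : 0 < γ₀) (hb₀ : 0 < b₀) (hrem : RemainderConst S γ₀ r)
    (hr : r ≤ b₀) (hup : BetaUpperH β' γ₀ β) (hlo : ∀ k, ∀ v ∈ Box γ₀ k, -β' ≤ β k v) (hcont : BetaContH γ₀ β)
    {C : B12.Construction} (hgen : ForwardGenerated C β) : EndpointExistence C :=
  (eventualFormOn S h hb hAdm hL hS hγ₀ hb₀ hrem hr hup hlo hcont).endpointExistence hgen

end ConsumersOn
end

end Literature.MathematicalPhysics.QuantumFieldTheory.Balaban1983to89.Beta.LargeL
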